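import Mathlib
import HarnessLib
import Summits.Ventures.LatticeQCDFlow.Exactness.SampleESS

/-!
# One record, three printed numbers: `⟨W⟩_ŵ ≤ dF_J ≤ ⟨W⟩` and `ess ≤ exp(−(dF_J − ⟨W⟩_ŵ))`, exactly

HONEST FRAMING: exact (Metropolis-corrected) sampling algorithms for lattice gauge theory;
figures of merit are autocorrelation/cost numbers at stated couplings and volumes; no
continuum-physics claim.

Venture `LatticeQCDFlow` (cell pub-lqcd), topic `Exactness`; FANOUT row 13 (`eng-snf`, GEN-25).
NEW WORK of the cell (finite Jensen / Gibbs), on the BUILT parent `Exactness/SampleESS` (`essHat`);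
Mathlib otherwise; not a published result; no definition; nothing cited as a fact.  Companion of
GEN-25 `…MeanWorkTruncation` (`dF_J ≤ ⟨W⟩`, the upper half of the sandwich) and the SAMPLE-LEVEL
counterpart of the population bound the two-sided summary quotes
(`BennettAcceptanceRatio.essPop_le_exp_neg_reverse_dissipation`: `ESS_F ≤ e^{−⟨W_d⟩_R}`).

WHY (row 13).  From ONE forward record of works `W_i` the engine prints the Jarzynski value
`dF_J = −log((1/n)Σ_i e^{−W_i})`, the Kish fraction `ess = (Σ_i w_i)²/(n Σ_i w_i²)` of the weights
`w_i = e^{−W_i}`, and — through `reweighted_mean(W, W)` — the target-ensemble (reweighted) mean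
work `⟨W⟩_ŵ = Σ_i w_i W_i / Σ_i w_i`.  With the normalised weights `p_i = w_i/Σw` these are
entropies: `dF_J − ⟨W⟩_ŵ = log n − H(p)` (`H` = Shannon) and `ess = e^{H₂(p)}/n` (`H₂` = Rényi-2),
so two Jensen inequalities for the concave `log` give, on EVERY record and with no model:

  **`⟨W⟩_ŵ ≤ dF_J`** (`weightedMeanWork_le_neg_log_avg_exp_neg`; Gibbs: `H(p) ≤ log n`) — the
  importance-sampling estimate `dF_J − ⟨W⟩_ŵ` of the REVERSE dissipation `⟨W_d⟩_R` is `≥ 0`;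
  **`ess ≤ exp(−(dF_J − ⟨W⟩_ŵ))`** (`essHat_le_exp_neg_sub_weightedMeanWork`; `H₂ ≤ H`) — the
  quoted population bound holds EXACTLY at sample level once `⟨W_d⟩_R` is replaced by its
  forward-run importance-sampling estimate.

So `bounds.ess_fwd_exceeds_bound_ratio > 1` can only come from the MEASURED reverse dissipation
exceeding its forward-run IS estimate — a forward/reverse inconsistency (undersampled weight
tails), exactly as the summary's `statement` field says, never an arithmetic accident.

* `neg_sum_mul_log_le_log_card` — Gibbs `H(p) ≤ log n`; `sum_mul_log_le_log_sum_sq` — `−H(p) ≤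
  −H₂(p)`; **`weightedMeanWork_le_neg_log_avg_exp_neg`**,
  **`essHat_le_exp_neg_sub_weightedMeanWork`**; `essHat_eq_inv_avg_exp_neg_two_mul_dissipation`
  (the module docstring's `ESS-hat = 1/⟨e^{−2W_d}⟩` as a sample identity).

NOT CLAIMED: anything about the population; equality cases; anything numerical.
-/

namespace Summit.Ventures.LatticeQCDFlow.Exactness.GeneralNCMC

open Finset Summit.Ventures.LatticeQCDFlow.Exactness

section Entropies

variable {ι : Type*} [Fintype ι]

/-- **Gibbs**: `−Σ_i p_i log p_i ≤ log n` for a positive probability vector on `n` points. -/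
theorem neg_sum_mul_log_le_log_card (p : ι → ℝ) (hp : ∀ i, 0 < p i) (hp1 : ∑ i, p i = 1) :
    -∑ i, p i * Real.log (p i) ≤ Real.log (Fintype.card ι) := by
  have hj := (strictConcaveOn_log_Ioi.concaveOn).le_map_sum (t := univ) (w := p)
    (p := fun i => (p i)⁻¹) (fun i _ => (hp i).le) hp1 (fun i _ => Set.mem_Ioi.2 (inv_pos.2 (hp i)))
  simp only [smul_eq_mul] at hj
  have h1 : ∑ i, p i * (p i)⁻¹ = Fintype.card ι := by
    rw [sum_congr rfl fun i _ => mul_inv_cancel₀ (hp i).ne', sum_const, card_univ, nsmul_eq_mul,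
      mul_one]
  rw [h1] at hj
  have h2 : ∑ i, p i * Real.log (p i)⁻¹ = -∑ i, p i * Real.log (p i) := by
    rw [← sum_neg_distrib]
    exact sum_congr rfl fun i _ => by rw [Real.log_inv, mul_neg]
  linarith [h2]

/-- **Rényi-2 below Shannon**: `Σ_i p_i log p_i ≤ log(Σ_i p_i²)` for a positive probability
vector. -/
theorem sum_mul_log_le_log_sum_sq (p : ι → ℝ) (hp : ∀ i, 0 < p i) (hp1 : ∑ i, p i = 1) :
    ∑ i, p i * Real.log (p i) ≤ Real.log (∑ i, p i ^ 2) := by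
  have hj := (strictConcaveOn_log_Ioi.concaveOn).le_map_sum (t := univ) (w := p)
    (p := fun i => p i) (fun i _ => (hp i).le) hp1 (fun i _ => Set.mem_Ioi.2 (hp i))
  simp only [smul_eq_mul] at hj
  have h1 : ∑ i, p i * p i = ∑ i, p i ^ 2 := sum_congr rfl fun i _ => by ring
  rw [h1] at hj
  exact hj

end Entropies

section Sandwich

variable {ι : Type*} [Fintype ι] [Nonempty ι]

/-- **`⟨W⟩_ŵ ≤ dF_J` on every record**: the reweighted (target-ensemble) mean work never exceeds
the Jarzynski value, `Σ_i e^{−W_i} W_i / Σ_i e^{−W_i} ≤ −log((1/n)Σ_i e^{−W_i})`. -/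
theorem weightedMeanWork_le_neg_log_avg_exp_neg (W : ι → ℝ) :
    (∑ i, Real.exp (-W i) * W i) / (∑ i, Real.exp (-W i))
      ≤ -Real.log ((∑ i, Real.exp (-W i)) / Fintype.card ι) := by
  set S := ∑ i, Real.exp (-W i) with hS
  have hSpos : 0 < S := sum_pos (fun i _ => Real.exp_pos _) univ_nonempty
  have hn : (0 : ℝ) < Fintype.card ι := by exact_mod_cast Fintype.card_pos
  -- normalised weights
  have hp : ∀ i, 0 < Real.exp (-W i) / S := fun i => div_pos (Real.exp_pos _) hSpos
  have hp1 : ∑ i, Real.exp (-W i) / S = 1 := by rw [← sum_div, div_self hSpos.ne']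
  -- `W_i = −log p_i − log S`
  have hW : ∀ i, W i = -Real.log (Real.exp (-W i) / S) - Real.log S := fun i => by
    rw [Real.log_div (Real.exp_pos _).ne' hSpos.ne', Real.log_exp]; ring
  have hL : (∑ i, Real.exp (-W i) * W i) / S
      = -(∑ i, Real.exp (-W i) / S * Real.log (Real.exp (-W i) / S)) - Real.log S := by
    rw [sum_div]
    have key : ∀ x w : ℝ, w = -Real.log (x / S) - Real.log S →
        x * w / S = -(x / S * Real.log (x / S)) - x / S * Real.log S := fun x w hw => by
      rw [hw]; ring
    have h : ∀ i, Real.exp (-W i) * W i / S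
        = -(Real.exp (-W i) / S * Real.log (Real.exp (-W i) / S))
          - Real.exp (-W i) / S * Real.log S := fun i => key _ _ (hW i)
    rw [sum_congr rfl fun i _ => h i, sum_sub_distrib, sum_neg_distrib, ← sum_mul, hp1, one_mul]
  rw [hL, Real.log_div hSpos.ne' hn.ne']
  linarith [neg_sum_mul_log_le_log_card _ hp hp1]

/-- **`ess ≤ exp(−(dF_J − ⟨W⟩_ŵ))` on every record**: the Kish fraction of the weights is at most
`exp` of minus the forward-run importance-sampling estimate of the reverse dissipation. -/
theorem essHat_le_exp_neg_sub_weightedMeanWork (W : ι → ℝ) :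
    essHat (fun i => Real.exp (-W i))
      ≤ Real.exp (-(-Real.log ((∑ i, Real.exp (-W i)) / Fintype.card ι)
          - (∑ i, Real.exp (-W i) * W i) / (∑ i, Real.exp (-W i)))) := by
  set S := ∑ i, Real.exp (-W i) with hS
  have hSpos : 0 < S := sum_pos (fun i _ => Real.exp_pos _) univ_nonempty
  have hn : (0 : ℝ) < Fintype.card ι := by exact_mod_cast Fintype.card_pos
  have hp : ∀ i, 0 < Real.exp (-W i) / S := fun i => div_pos (Real.exp_pos _) hSpos
  have hp1 : ∑ i, Real.exp (-W i) / S = 1 := by rw [← sum_div, div_self hSpos.ne']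
  have hW : ∀ i, W i = -Real.log (Real.exp (-W i) / S) - Real.log S := fun i => by
    rw [Real.log_div (Real.exp_pos _).ne' hSpos.ne', Real.log_exp]; ring
  -- Shannon term
  set H := -(∑ i, Real.exp (-W i) / S * Real.log (Real.exp (-W i) / S)) with hH
  have hL : (∑ i, Real.exp (-W i) * W i) / S = H - Real.log S := by
    rw [hH, sum_div]
    have key : ∀ x w : ℝ, w = -Real.log (x / S) - Real.log S →
        x * w / S = -(x / S * Real.log (x / S)) - x / S * Real.log S := fun x w hw => by
      rw [hw]; ring
    have h : ∀ i, Real.exp (-W i) * W i / S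
        = -(Real.exp (-W i) / S * Real.log (Real.exp (-W i) / S))
          - Real.exp (-W i) / S * Real.log S := fun i => key _ _ (hW i)
    rw [sum_congr rfl fun i _ => h i, sum_sub_distrib, sum_neg_distrib, ← sum_mul, hp1, one_mul]
  -- the exponent is `H − log n`
  have hexp : -(-Real.log (S / Fintype.card ι) - (∑ i, Real.exp (-W i) * W i) / S)
      = H - Real.log (Fintype.card ι) := by
    rw [hL, Real.log_div hSpos.ne' hn.ne']; ring
  rw [hexp, Real.exp_sub, Real.exp_log hn]
  -- `essHat = 1/(n Σ p²)`
  have hsq : 0 < ∑ i, (Real.exp (-W i) / S) ^ 2 :=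
    sum_pos (fun i _ => pow_pos (hp i) 2) univ_nonempty
  have hess : essHat (fun i => Real.exp (-W i))
      = 1 / ((Fintype.card ι : ℝ) * ∑ i, (Real.exp (-W i) / S) ^ 2) := by
    unfold essHat
    have h2 : ∑ i, (Real.exp (-W i) / S) ^ 2 = (∑ i, Real.exp (-W i) ^ 2) / S ^ 2 := by
      rw [sum_div]; exact sum_congr rfl fun i _ => by rw [div_pow]
    rw [h2, ← hS]
    have hsq' : (∑ i, Real.exp (-W i) ^ 2) ≠ 0 :=
      (sum_pos (fun i _ => pow_pos (Real.exp_pos _) 2) univ_nonempty).ne'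
    field_simp
  rw [hess]
  -- `1/(n Σp²) ≤ e^{H}/n` from `−H ≤ log Σ p²`
  have hle : Real.exp (-H) ≤ ∑ i, (Real.exp (-W i) / S) ^ 2 := by
    have h := sum_mul_log_le_log_sum_sq _ hp hp1
    have hH' : -H = ∑ i, Real.exp (-W i) / S * Real.log (Real.exp (-W i) / S) := by
      rw [hH, neg_neg]
    rw [hH']
    calc Real.exp (∑ i, Real.exp (-W i) / S * Real.log (Real.exp (-W i) / S))
        ≤ Real.exp (Real.log (∑ i, (Real.exp (-W i) / S) ^ 2)) := Real.exp_le_exp.2 h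
      _ = ∑ i, (Real.exp (-W i) / S) ^ 2 := Real.exp_log hsq
  have hH2 : (∑ i, (Real.exp (-W i) / S) ^ 2)⁻¹ ≤ Real.exp H := by
    have h := inv_anti₀ (Real.exp_pos (-H)) hle
    rwa [Real.exp_neg, inv_inv] at h
  calc 1 / ((Fintype.card ι : ℝ) * ∑ i, (Real.exp (-W i) / S) ^ 2)
      = (∑ i, (Real.exp (-W i) / S) ^ 2)⁻¹ / Fintype.card ι := by
        rw [div_eq_mul_inv _ (Fintype.card ι : ℝ), one_div, mul_inv, mul_comm]
    _ ≤ Real.exp H / Fintype.card ι := div_le_div_of_nonneg_right hH2 hn.le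

/-- **`ess = 1/mean(e^{−2 Ŵ_d})` exactly** (the module docstring's "eq. ess" at sample level): with
the sample dissipation `Ŵ_{d,i} = W_i − dF_J`, `essHat(e^{−W}) = ((1/n)Σ_i e^{−2 Ŵ_{d,i}})⁻¹`. -/
theorem essHat_eq_inv_avg_exp_neg_two_mul_dissipation (W : ι → ℝ) :
    essHat (fun i => Real.exp (-W i))
      = ((∑ i, Real.exp (-2 * (W i - -Real.log ((∑ j, Real.exp (-W j)) / Fintype.card ι))))
          / Fintype.card ι)⁻¹ := by
  set S := ∑ i, Real.exp (-W i) with hS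
  have hSpos : 0 < S := sum_pos (fun i _ => Real.exp_pos _) univ_nonempty
  have hn : (0 : ℝ) < Fintype.card ι := by exact_mod_cast Fintype.card_pos
  have hSn : 0 < S / Fintype.card ι := div_pos hSpos hn
  -- `e^{−2(W_i + log(S/n))} = e^{−W_i}·e^{−W_i}·((S/n)(S/n))⁻¹`
  have hterm : ∀ i, Real.exp (-2 * (W i - -Real.log (S / Fintype.card ι)))
      = Real.exp (-W i) * Real.exp (-W i) / (S / Fintype.card ι * (S / Fintype.card ι)) :=
      fun i => by
    rw [show -2 * (W i - -Real.log (S / Fintype.card ι))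
        = (-W i + -W i) - (Real.log (S / Fintype.card ι) + Real.log (S / Fintype.card ι)) by ring,
      Real.exp_sub, Real.exp_add, Real.exp_add, Real.exp_log hSn]
  simp_rw [hterm]
  rw [← sum_div]
  have hsq : ∑ i, Real.exp (-W i) * Real.exp (-W i) = ∑ i, Real.exp (-W i) ^ 2 :=
    sum_congr rfl fun i _ => by ring
  rw [hsq]
  have hsq' : (∑ i, Real.exp (-W i) ^ 2) ≠ 0 :=
    (sum_pos (fun i _ => pow_pos (Real.exp_pos _) 2) univ_nonempty).ne'
  unfold essHat
  rw [← hS]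
  field_simp

end Sandwich

end Summit.Ventures.LatticeQCDFlow.Exactness.GeneralNCMC
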